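import Summits.ABC.ABC.Theorems.IsogenyGlueCongruenceFrameOverPetersson
import Literature.NumberTheory.EllipticCurves.NewformPeterssonSizeSiegelProofs
import HarnessLib

/-!
# Route IsogenyGlueCongruence — item `Assembly` (stmt-ABC-2049): `SemistableDegreeConjecture → ABC`

The route's rank-1 assembly `Assembly := SemistableDegreeConjecture → ABC` is the classical reduction
"sharp modular-degree conjecture for semistable elliptic curves over `ℚ` ⟹ abc" (Frey 1989;
M. R. Murty 1999, Thm. 1 (i); Pasten 2024, §3 and Rem. 3.3). Its proof in print has exactly one
analytic input that the tree holds only as an undischarged NAMED FACT: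

* `Literature.NumberTheory.EllipticCurves.ModularForms.murty_petersson_newform_lower_bound` — the
  Petersson lower bound `Re (f, f)_{Γ₀(N)} ≥ c(ε) N^{1−ε}` for the newform `f` of an elliptic curve of
  conductor `N` (Hoffstein–Lockhart 1994, Thm. 0.1, with the appendix of Goldfeld–Hoffstein–Lieman;
  Murty 1999 §2). In the tree it is reduced (`NewformPeterssonSizeSiegelProofs`) to the absence of an
  exceptional real zero of the Rankin–Selberg trace zeta function `Z_f` on
  `[1 − 1/(A log(N+2)), 1]`, i.e. to "no Siegel zero for `Sym² f`".

Everything else is proved in the tree (Zagier's identity `4π²c²(f,f) = deg · covol Λ`, Silverman's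
covolume inequality `silverman1986_discriminant_c4_covolume_holds`, the semistable minimal Frey
curve of a Serre-normalised triple, the `(u⁸, v⁸ − u⁸, v⁸)` reduction), assembled as
`Summit.ABC.ABC.Theorems.frameOverPetersson_proof : FrameOverPetersson`
(= `PeterssonLowerBound → SemistableDegreeConjecture → ABCConjecture`, item stmt-ABC-10885, proved).

This file records the three honest forms of `Assembly` available today:

* `assembly_of_petersson` — `Assembly` CONDITIONALLY on the named fact (trust base: that one name);
* `assembly_of_peterssonLowerBound` — the same with the hypothesis spelled as the route decl
  `PeterssonLowerBound` (item stmt-ABC-10870; definitionally the named fact);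
* `assembly_of_noExceptionalZero` — the same from the de la Vallée-Poussin-type zero-free interval
  for `Z_f` along the newforms of elliptic curves (the shape of Goldfeld–Hoffstein–Lieman's theorem),
  through `murty_petersson_newform_lower_bound_of_noExceptionalZero`.

Why the Petersson bound cannot be bypassed (so that `Assembly` closes the day the fact lands and not
before): the degree conjecture bounds `deg φ_E ≤ C N^{2+ε}`, and Zagier's identity turns this into
`covol Λ_E ≥ 4π²(f,f)/(C N^{2+ε})`; with a Petersson bound `(f,f) ≥ c N^{1−η−ε}` of deficiency `η`,
Silverman's inequality and `c² ≤ 2 c₄` for the minimal Frey model give `c ≤ C' rad(abc)^{1+η+ε}` on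
the triples with `16 ∣ abc` (sibling file `IsogenyGlueCongruenceAssemblyDeficiency`,
`abcLe_sixteen_of_semistableDegreeBound_of_deficiency`). The tree PROVES deficiency `η = 1/2`
(Iwaniec's elementary `(f,f) ≫ N^{1/2−δ}`, `murty_petersson_newform_lower_bound_of_half_lt`), whence
the unconditional shadow `c ≤ C(ε) rad(abc)^{3/2+ε}` on `16 ∣ abc`
(`abcLe_threeHalves_sixteen_of_semistableDegreeConjecture`); the exponent `1 + ε'` for every `ε' > 0`
needs deficiency `0`, i.e. `(f,f) ≫_δ N^{1−δ}` for EVERY `δ > 0`, which is the named fact itself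
(equivalently `L(1, Sym² f) ≫_δ N^{−δ}`, `murty_petersson_newform_lower_bound_iff_symmSqLOne_lower_bound`).
The hypothesis `SemistableDegreeConjecture` only bounds `(f,f)/covol` from above, for any curve, so it
cannot supply the missing lower bound.

## References

* G. Frey, *Links between solutions of A − B = C and elliptic curves*, LNM 1380 (1989). [Frey1989]
* M. R. Murty, *Bounds for congruence primes*, Proc. Sympos. Pure Math. 66.1 (1999), Thm. 1, §2.
  [MurtyCongruencePrimes1999]
* H. Pasten, *Shimura curves and the abc conjecture*, J. Number Theory 254 (2024) =
  arXiv:1705.09251, §3 Rem. 3.3. [PastenShimura2024]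
* J. Hoffstein, P. Lockhart, *Coefficients of Maass forms and the Siegel zero* (appendix by
  D. Goldfeld, J. Hoffstein, D. Lieman), Ann. of Math. 140 (1994), 161–181. [HoffsteinLockhart1994]
-/

-- `Summit.<Summit>.<Problem>` is the mandated summit-side namespace (CONVENTIONS §2); for the
-- single-conjunct summit `ABC` the two coincide, so the duplicate `ABC.ABC` is deliberate.
set_option linter.dupNamespace false

namespace Summit.ABC.ABC.Theorems

open Literature.NumberTheory.EllipticCurves Literature.NumberTheory.EllipticCurves.ModularForms
open Literature.NumberTheory.Automorphic CongruenceSubgroup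
open _root_.MeasureTheory

/-- **Item stmt-ABC-2049 (`Assembly`), conditionally on the Petersson lower bound.** If the newform
of every elliptic curve over `ℚ` of conductor `N` has Petersson norm `Re (f,f)_{Γ₀(N)} ≥ c(ε) N^{1−ε}`
(the named fact `murty_petersson_newform_lower_bound`, Hoffstein–Lockhart 1994 / Murty 1999), then the
sharp modular-degree conjecture for semistable elliptic curves over `ℚ` implies the abc conjecture:
`SemistableDegreeConjecture → ABC`. Proof: `ABC` unfolds to `Literature.Abc.ABCConjecture`, and
`frameOverPetersson_proof hP` is exactly this arrow. CONDITIONAL: trust base = the one named fact.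
[cite: MurtyCongruencePrimes1999, Thm. 1 (i)] -/
theorem assembly_of_petersson (hP : murty_petersson_newform_lower_bound) :
    Summit.ABC.ABC.Theses.IsogenyGlueCongruence.Assembly := by
  unfold Summit.ABC.ABC.Theses.IsogenyGlueCongruence.Assembly
  intro hX
  exact frameOverPetersson_proof hP hX

/-- **`Assembly` from the route's own item `PeterssonLowerBound`** (stmt-ABC-10870, whose body is
verbatim the named fact `murty_petersson_newform_lower_bound`): `PeterssonLowerBound → Assembly`.
[cite: MurtyCongruencePrimes1999, Thm. 1 (i)] -/
theorem assembly_of_peterssonLowerBound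
    (hP : Summit.ABC.ABC.Theses.IsogenyGlueCongruence.PeterssonLowerBound) :
    Summit.ABC.ABC.Theses.IsogenyGlueCongruence.Assembly :=
  assembly_of_petersson hP

/-- **`Assembly` from "no exceptional zero".** If for some `A > 0` the completed Rankin–Selberg
trace zeta function `Z_f(σ) = σ(σ−1) ∫_𝒟 G_f E₀*(·,σ) dμ + ½ ∫_𝒟 G_f dμ` of the newform `f` of every
elliptic curve over `ℚ` (level `N`) does not vanish for `1 − 1/(A log(N+2)) ≤ σ ≤ 1` — the
de la Vallée-Poussin-type zero-free interval that Goldfeld–Hoffstein–Lieman establish for `Sym² f`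
(appendix to Hoffstein–Lockhart 1994) — then `SemistableDegreeConjecture → ABC`. Composition of the
tree's conditional discharge `murty_petersson_newform_lower_bound_of_noExceptionalZero`
(Estermann's lemma on the disc `|s − 2| ≤ 5/4`) with `assembly_of_petersson`.
[cite: HoffsteinLockhart1994, Thm. 0.1 and appendix (no Siegel zero)] -/
theorem assembly_of_noExceptionalZero
    (h : ∃ A : ℝ, 0 < A ∧ ∀ (N : ℕ) [NeZero N] (W : WeierstrassCurve ℚ) (f : CuspForm (Gamma0 N) 2),
      IsNewformOf W f → ∀ σ : ℝ, 1 - 1 / (A * Real.log (N + 2)) ≤ σ → σ ≤ 1 →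
        (σ : ℂ) * (σ - 1) *
            (∫ w in ModularGroup.fd, (rsTrace N 2 f w : ℂ) * completedEisenstein₀ w σ) +
          (((∫ w in ModularGroup.fd, rsTrace N 2 f w : ℝ)) : ℂ) / 2 ≠ 0) :
    Summit.ABC.ABC.Theses.IsogenyGlueCongruence.Assembly :=
  assembly_of_petersson (murty_petersson_newform_lower_bound_of_noExceptionalZero h)

end Summit.ABC.ABC.Theorems
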